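import Literature.NumberTheory.Sieve.PolymathGEHSmoothPart
import Literature.NumberTheory.Sieve.PolymathGEHAlmostPrimeSieve
import Literature.NumberTheory.Sieve.PolymathGEHEulerSums
import Literature.NumberTheory.Sieve.PolymathGEHFourierMajorant
import Literature.NumberTheory.Sieve.PolymathLcmSums
import HarnessLib

/-!
# Proposition 4.2 (almost primality), case `a_j = 2`: the sum over `n` with a small prime factor

Trunk AntSieve, tooling toward the named fact `Literature.NumberTheory.Sieve.weakDHL_three_two_of_GEH`
(D. H. J. Polymath, Res. Math. Sci. 1:12 (2014) = arXiv:1407.4897, Theorem 3.2(xii)), here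
Proposition 4.2, (lambdatau-fix2) with `a_j = 2`, `m_j = 0`, p. 14: "As a consequence, we have
`Σ_{x ≤ n ≤ 2x: n = b (W)} ∏_{j=1}^k |λ_{F_j}(n+h_j)|^{a_j} τ(n+h_j)^{m_j} 1_{p(n+h_{j_0}) ≤ x^ε} ≪ ε B^{-k} x/W`
for any `ε > 0`, where `p(n)` denotes the least prime factor of `n`", assembled from the smooth/rough
factorisation (`PolymathGEHSmoothPart`), the sieve count (`PolymathGEHAlmostPrimeSieve`), the
Euler-product bounds (`PolymathGEHEulerSums`) and the Fourier majorant (`PolymathGEHFourierMajorant`).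

* `SmallPrime.arith_bound` — (xnx): the arithmetic sum for Euler-product weights, for fixed `σ_h ≥ 1`;
* `SmallPrime.fourier_induction` — converting `λ_h²` into Euler-product weights one shift at a time;
* `sum_sq_divisorSumWeights_smallPrime_le` — **(lambdatau-fix2)**: for every family of cutoffs
  there is `C` with `Σ_n 1_{p(n+h₀) ≤ x^ε} ∏_h λ_{E_h}(n+h)² ≤ C ε x/(B^k W)` eventually, for all
  `0 < ε ≤ 1`.

## References

* [Polymath8b2014] D. H. J. Polymath, Res. Math. Sci. 1 (2014), Art. 12 = arXiv:1407.4897,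
  Proposition 4.2 and its proof, pp. 14–16.
-/

noncomputable section

open MeasureTheory Finset Real Filter
open scoped ArithmeticFunction.Omega ArithmeticFunction.omega

namespace Literature.NumberTheory.Sieve

open scoped Classical
open SmoothPart AlmostPrimeSieve EulerSums FourierMajorant

namespace SmallPrime

/-! ### Constants -/

/-- `c₂ = 4^{80k}`: `4^{ω(m')} ≤ c₂^{Ω(d)+1}` for the rough part. [folklore] -/
def c2 (k : ℕ) : ℝ := 4 ^ (80 * k)

/-- `cG = 4 c₂`, the constant of the `G`-weights. [folklore] -/
def cG (k : ℕ) : ℝ := 4 * c2 k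

/-- `cF = cG 2^{k+1}`, the constant of the `F`-weights. [folklore] -/
def cF (k : ℕ) : ℝ := cG k * 2 ^ (k + 1)

/-- `1 ≤ c₂`. [folklore] -/
theorem one_le_c2 (k : ℕ) : 1 ≤ c2 k := one_le_pow₀ (by norm_num)
/-- `1 ≤ cG`. [folklore] -/
theorem one_le_cG (k : ℕ) : 1 ≤ cG k := by unfold cG; nlinarith [one_le_c2 k]
/-- `cG ≤ cF`. [folklore] -/
theorem cG_le_cF (k : ℕ) : cG k ≤ cF k := by
  unfold cF; exact le_mul_of_one_le_right (by linarith [one_le_cG k]) (one_le_pow₀ (by norm_num))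
/-- `1 ≤ cF`. [folklore] -/
theorem one_le_cF (k : ℕ) : 1 ≤ cF k := (one_le_cG k).trans (cG_le_cF k)

/-! ### Step A: the pointwise weight bound through the smooth part -/

/-- `eulerMajor σ x m = ∏_{p ∣ m} mw σ x p`. [folklore] -/
theorem eulerMajor_eq_prod_mw (σ x : ℝ) (m : ℕ) : eulerMajor σ x m = ∏ p ∈ m.primeFactors, mw σ x p := rfl

/-- Restricting the Euler majorant to the prime factors of a divisor only increases it. [folklore] -/
theorem eulerMajor_le_of_dvd {σ x : ℝ} (hσ : 0 ≤ σ) (hx : 1 ≤ x) {d m : ℕ} (hdm : d ∣ m) (hm : m ≠ 0) :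
    eulerMajor σ x m ≤ eulerMajor σ x d := by
  rw [eulerMajor_eq_prod_mw, eulerMajor_eq_prod_mw, ← Finset.prod_sdiff (Nat.primeFactors_mono hdm hm)]
  refine mul_le_of_le_one_left (Finset.prod_nonneg fun p _ => mw_nonneg hσ hx p) ?_
  exact Finset.prod_le_one (fun p _ => mw_nonneg hσ hx p) fun p _ => mw_le_one σ x p

/-- **Step A.** For `1 ≤ m ≤ 3x`, `x ≥ 3`, `k ≥ 1`, `y = x^{1/40k}`, `σ ≥ 0`:
`4^{ω(m)} ∏_{p∣m} mw(p) ≤ c₂ · G_{cG}(d)` with `d` the smooth part of `m`. [cite: Polymath8b2014, proof of Prop. 4.2, p. 15] -/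
theorem weight_le_smoothPart {k : ℕ} (hk : 1 ≤ k) {x : ℝ} (hx : 3 ≤ x) {σ : ℝ} (hσ : 0 ≤ σ) {m : ℕ} (hm : m ≠ 0)
    (hm3 : (m : ℝ) ≤ 3 * x) :
    (4 : ℝ) ^ ω m * eulerMajor σ x m ≤ c2 k * Gw (cG k) σ x (smoothPart (x ^ (1 / (40 * (k : ℝ)))) m) := by
  set y := x ^ (1 / (40 * (k : ℝ))) with hy
  set d := smoothPart y m with hd
  set r := roughPart y m with hr
  have hx1 : (1 : ℝ) ≤ x := by linarith
  have hx0 : 0 < x := by linarith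
  have hlogx : 0 < Real.log x := Real.log_pos (by linarith)
  have hy1 : 1 < y := Real.one_lt_rpow (by linarith) (by positivity)
  have hd0 : d ≠ 0 := (smoothPart_pos y m).ne'
  have hlogy : Real.log y = Real.log x / (40 * k) := by rw [hy, Real.log_rpow hx0]; ring
  -- `Ω(r) ≤ 80k (Ω(d) + 1)`
  have hΩr : (Ω r : ℝ) ≤ 80 * k * (Ω d + 1) := by
    have h := cardFactors_roughPart_mul_log_le hy1 hm
    rw [← hd, ← hr, hlogy] at h
    have hlogm : Real.log m ≤ 2 * Real.log x := by
      have h3 : Real.log m ≤ Real.log (3 * x) := Real.log_le_log (by exact_mod_cast Nat.pos_of_ne_zero hm) hm3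
      rw [Real.log_mul (by norm_num) hx0.ne'] at h3
      have : Real.log 3 ≤ Real.log x := Real.log_le_log (by norm_num) hx
      linarith
    have hk0 : (0 : ℝ) < 40 * k := by positivity
    rw [mul_div_assoc', div_le_iff₀ hk0] at h
    have hΩd0 : (0 : ℝ) ≤ Ω d + 1 := by positivity
    -- `Ω r · log x ≤ (Ω d + 1) log m · 40k ≤ (Ω d + 1) · 2 log x · 40 k`
    have h2 : (Ω r : ℝ) * Real.log x ≤ (80 * k * (Ω d + 1)) * Real.log x := by
      calc (Ω r : ℝ) * Real.log x ≤ (Ω d + 1 : ℝ) * Real.log m * (40 * k) := h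
        _ ≤ (Ω d + 1 : ℝ) * (2 * Real.log x) * (40 * k) := by gcongr
        _ = (80 * k * (Ω d + 1)) * Real.log x := by ring
    exact le_of_mul_le_mul_right h2 hlogx
  have hΩr' : Ω r ≤ 80 * k * (Ω d + 1) := by exact_mod_cast hΩr
  -- `4^{ω(m)} ≤ 4^{ω(d)} 4^{ω(r)} ≤ 4^{Ω d} · c₂ · c₂^{Ω d}`
  have h4 : (4 : ℝ) ^ ω m ≤ 4 ^ Ω d * (c2 k * c2 k ^ Ω d) := by
    calc (4 : ℝ) ^ ω m ≤ 4 ^ (ω d + ω r) := pow_le_pow_right₀ (by norm_num) (cardDistinctFactors_le_add y hm)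
      _ = 4 ^ ω d * 4 ^ ω r := pow_add _ _ _
      _ ≤ 4 ^ Ω d * 4 ^ (80 * k * (Ω d + 1)) :=
          mul_le_mul (pow_le_pow_right₀ (by norm_num) (cardDistinctFactors_le_cardFactors d))
            (pow_le_pow_right₀ (by norm_num) ((cardDistinctFactors_le_cardFactors r).trans hΩr')) (by positivity) (by positivity)
      _ = 4 ^ Ω d * (c2 k * c2 k ^ Ω d) := by
          rw [c2, ← pow_mul, ← pow_add]; ring
  rw [Gw_apply hd0, ← eulerMajor_eq_prod_mw]
  have hEd : eulerMajor σ x m ≤ eulerMajor σ x d := eulerMajor_le_of_dvd hσ hx1 (smoothPart_dvd y hm) hm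
  have hE0 : 0 ≤ eulerMajor σ x m := eulerMajor_nonneg hσ hx1 m
  have hc2 : 0 ≤ c2 k := by linarith [one_le_c2 k]
  calc (4 : ℝ) ^ ω m * eulerMajor σ x m ≤ (4 ^ Ω d * (c2 k * c2 k ^ Ω d)) * eulerMajor σ x d :=
        mul_le_mul h4 hEd hE0 (by positivity)
    _ = c2 k * ((cG k) ^ Ω d * eulerMajor σ x d) := by rw [cG, mul_pow]; ring

/-! ### Step B: the arithmetic sum (xnx) for Euler-product weights -/

section StepB

/-- The shifted integer `n + h` as a natural number. [folklore] -/
def mOf (n : ℕ) (h : ℤ) : ℕ := ((n : ℤ) + h).toNat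

/-- The tuple of smooth parts `(d_h)_{h ∈ H}`. [cite: Polymath8b2014, proof of Prop. 4.2, p. 15] -/
def dvec (H : Finset ℤ) (y : ℝ) (n : ℕ) : ↥H → ℕ := fun h => smoothPart y (mOf n h)

/-- `n + h₀` has a prime factor `≤ z`. [cite: Polymath8b2014, Prop. 4.2, (lambdatau-fix2)] -/
def badN (z : ℝ) (h₀ : ℤ) (n : ℕ) : Prop := ∃ p : ℕ, p.Prime ∧ p ∣ mOf n h₀ ∧ (p : ℝ) ≤ z

/-- Extension of a tuple on `H` to all of `ℤ` (by `1`). [folklore] -/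
def extD (H : Finset ℤ) (d : ↥H → ℕ) : ℤ → ℕ := fun h => if hh : h ∈ H then d ⟨h, hh⟩ else 1

/-- `extD` on `H`. [folklore] -/
theorem extD_apply {H : Finset ℤ} (d : ↥H → ℕ) {h : ℤ} (hh : h ∈ H) : extD H d h = d ⟨h, hh⟩ := by
  rw [extD, dif_pos hh]

/-- `Ω` of a finite product of nonzero naturals. [folklore] -/
theorem cardFactors_finset_prod {ι : Type*} (s : Finset ι) {f : ι → ℕ} (hf : ∀ i ∈ s, f i ≠ 0) :
    Ω (∏ i ∈ s, f i) = ∑ i ∈ s, Ω (f i) := by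
  induction s using Finset.induction_on with
  | empty => simp
  | insert a s ha ih =>
    rw [Finset.prod_insert ha, Finset.sum_insert ha,
      ArithmeticFunction.cardFactors_mul (hf a (Finset.mem_insert_self a s))
        (Finset.prod_ne_zero_iff.2 fun i hi => hf i (Finset.mem_insert_of_mem hi)),
      ih fun i hi => hf i (Finset.mem_insert_of_mem hi)]

variable {H : Finset ℤ} {x : ℝ} {b : ℤ}

/-- Facts about `n + h` for `n` in the summation range (`x ≥ M + 2`, `(b + h, W) = 1`). [folklore] -/
theorem mOf_facts (hx : (shiftM H : ℝ) + 2 ≤ x) (hb : ∀ h ∈ H, Int.gcd (b + h) (polymathW x) = 1)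
    {n : ℕ} (hn : n ∈ polymathRange x b) {h : ℤ} (hh : h ∈ H) :
    1 ≤ (n : ℤ) + h ∧ ((mOf n h : ℕ) : ℤ) = n + h ∧ mOf n h ≠ 0 ∧ (mOf n h : ℝ) ≤ 3 * x ∧ (mOf n h).Coprime (polymathW x) := by
  have hx0 : 0 ≤ x := by linarith [Nat.cast_nonneg (α := ℝ) (shiftM H)]
  obtain ⟨hxn, hn2x⟩ := le_of_mem_polymathRange hx0 hn
  have hhM : |h| ≤ shiftM H := by
    have := natAbs_le_shiftM hh
    rw [Int.abs_eq_natAbs]; exact_mod_cast this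
  have hhM' : |(h : ℝ)| ≤ shiftM H := by exact_mod_cast hhM
  rw [abs_le] at hhM'
  have h1r : (1 : ℝ) ≤ n + h := by linarith
  have h1 : 1 ≤ (n : ℤ) + h := by exact_mod_cast h1r
  have hcast : ((mOf n h : ℕ) : ℤ) = n + h := by rw [mOf, Int.toNat_of_nonneg (by linarith)]
  have hm0 : mOf n h ≠ 0 := by intro h0; rw [h0] at hcast; simp at hcast; linarith
  have hm3 : (mOf n h : ℝ) ≤ 3 * x := by
    have : ((mOf n h : ℕ) : ℝ) = (n : ℝ) + h := by exact_mod_cast hcast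
    rw [this]; linarith
  refine ⟨h1, hcast, hm0, hm3, ?_⟩
  -- coprimality with `W`
  have hmod : (n : ℤ) ≡ b [ZMOD (polymathW x : ℤ)] := (Finset.mem_filter.1 hn).2
  refine Nat.coprime_of_dvd fun p hp hpm hpW => ?_
  have h1 : (p : ℤ) ∣ (n : ℤ) + h := by rw [← hcast]; exact Int.natCast_dvd_natCast.2 hpm
  have h2 : (p : ℤ) ∣ b - n := (Int.natCast_dvd_natCast.2 hpW).trans hmod.dvd
  have h3 : (p : ℤ) ∣ b + h := by
    have : b + h = (n : ℤ) + h + (b - n) := by ring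
    rw [this]; exact dvd_add h1 h2
  have h4 : p ∣ Int.gcd (b + h) (polymathW x) := Int.dvd_gcd h3 (Int.natCast_dvd_natCast.2 hpW)
  rw [hb h hh] at h4
  exact hp.one_lt.ne' (Nat.dvd_one.1 h4)

/-- `Ω` is monotone under divisibility (nonzero multiple). [folklore] -/
theorem cardFactors_le_of_dvd {a b : ℕ} (hab : a ∣ b) (hb : b ≠ 0) : Ω a ≤ Ω b := by
  obtain ⟨c, rfl⟩ := hab
  have ha : a ≠ 0 := left_ne_zero_of_mul hb
  have hc : c ≠ 0 := right_ne_zero_of_mul hb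
  rw [ArithmeticFunction.cardFactors_mul ha hc]; omega

/-- **The fibre of the smooth-part map lies in the sieve count set** `cnt` of
`PolymathGEHAlmostPrimeSieve` (with `R = x^{1/(40k(Ω(∏ d_h)+1))}`). [cite: Polymath8b2014, proof of Prop. 4.2, p. 15] -/
theorem fiber_subset_cnt (hxM : (shiftM H : ℝ) + 2 ≤ x) (hb : ∀ h ∈ H, Int.gcd (b + h) (polymathW x) = 1)
    (d : ↥H → ℕ) :
    (polymathRange x b).filter (fun n => dvec H (x ^ (1 / (40 * (H.card : ℝ)))) n = d) ⊆
      cnt H x b (extD H d) (x ^ (1 / (40 * (H.card : ℝ) * (Ω (∏ h ∈ H, extD H d h) + 1)))) := by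
  set k := H.card with hk
  set y := x ^ (1 / (40 * (k : ℝ))) with hy
  set D := ∏ h ∈ H, extD H d h with hD
  set R := x ^ (1 / (40 * (k : ℝ) * (Ω D + 1))) with hR
  have hx0 : 0 < x := by linarith [Nat.cast_nonneg (α := ℝ) (shiftM H)]
  intro n hn
  obtain ⟨hrange, hdn⟩ := Finset.mem_filter.1 hn
  have hfacts := fun h hh => mOf_facts hxM hb hrange (h := h) hh
  have hdh : ∀ h (hh : h ∈ H), extD H d h = smoothPart y (mOf n h) := fun h hh => by
    rw [extD_apply d hh, ← hdn]; rfl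
  rw [mem_cnt]
  refine ⟨hrange, fun h hh => ?_, fun p hp hpR hpWD h hh hpdvd => ?_⟩
  · rw [← (hfacts h hh).2.1, Int.natCast_dvd_natCast, hdh h hh]
    exact smoothPart_dvd y (hfacts h hh).2.2.1
  · obtain ⟨-, hcast, hm0, -, -⟩ := hfacts h hh
    rw [← hcast, Int.natCast_dvd_natCast] at hpdvd
    have hDne : D ≠ 0 := Finset.prod_ne_zero_iff.2 fun h' hh' => by rw [hdh h' hh']; exact (smoothPart_pos y _).ne'
    have hdD : extD H d h ∣ D := Finset.dvd_prod_of_mem _ hh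
    have hpd : ¬ p ∣ extD H d h := fun h1 => hpWD (dvd_mul_of_dvd_right (h1.trans hdD) _)
    -- so `p` divides the rough part
    rw [← smoothPart_mul_roughPart y hm0, ← hdh h hh] at hpdvd
    have hpr : p ∣ roughPart y (mOf n h) := (Nat.Prime.dvd_mul hp).1 hpdvd |>.resolve_left hpd
    have hmem : p ∈ (roughPart y (mOf n h)).primeFactors := Nat.mem_primeFactors.2 ⟨hp, hpr, (roughPart_pos y _).ne'⟩
    have hle := le_pow_of_mem_primeFactors_roughPart hmem
    rw [← hdh h hh] at hle
    -- `p^{Ω d_h + 1} ≤ p^{Ω D + 1} < R^{Ω D + 1} = y`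
    have hΩle : Ω (extD H d h) ≤ Ω D := cardFactors_le_of_dvd hdD hDne
    have hp1 : (1 : ℝ) ≤ p := by exact_mod_cast hp.one_le
    have hRy : R ^ (Ω D + 1) = y := by
      rw [hR, hy, ← Real.rpow_natCast, ← Real.rpow_mul hx0.le]
      congr 1; push_cast; field_simp
    have hlt : (p : ℝ) ^ (Ω D + 1) < y := by
      rw [← hRy]; exact pow_lt_pow_left₀ hpR (Nat.cast_nonneg _) (by omega)
    have hle' : y ≤ (p : ℝ) ^ (Ω D + 1) := hle.trans (pow_le_pow_right₀ hp1 (by omega))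
    linarith

/-- `cF` as a natural number. [folklore] -/
def cFn (k : ℕ) : ℕ := 4 * 4 ^ (80 * k) * 2 ^ (k + 1)

/-- `cF = cFn`. [folklore] -/
theorem cF_eq (k : ℕ) : cF k = (cFn k : ℝ) := by unfold cF cG c2 cFn; push_cast; ring

/-- The exponent `N = 2 cF + 1` of the polynomial dependence on `σ`. [folklore] -/
def Nexp (k : ℕ) : ℕ := 2 * cFn k + 1

/-- The constant of the arithmetic bound. [folklore] -/
def K₁ (k : ℕ) : ℝ := c2 k ^ k * countConst k * (58 * cF k) * Real.exp (56 * cF k) ^ k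

/-- `G_{cG}(d) 2^{(k+1)Ω(d)}/d = F_{cF}(d)`. [folklore] -/
theorem Gw_mul_eq_Fw (k : ℕ) (σ x : ℝ) (d : ℕ) : Gw (cG k) σ x d * (2 ^ ((k + 1) * Ω d) / d) = Fw (cF k) σ x d := by
  rcases eq_or_ne d 0 with rfl | hd
  · simp [Gw, Fw]
  · rw [Gw_apply hd, Fw_apply hd, cF, mul_pow, ← pow_mul]; ring

/-- The arithmetic sum (xnx) for Euler-product weights `σ_h`. [cite: Polymath8b2014, proof of Prop. 4.2, p. 15, (xnx)] -/
def arithQ (H : Finset ℤ) (x : ℝ) (b : ℤ) (z : ℝ) (h₀ : ℤ) (σ : ℤ → ℝ) : ℝ :=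
  ∑ n ∈ (polymathRange x b).filter (badN z h₀), ∏ h ∈ H, (4 : ℝ) ^ ω (mOf n h) * eulerMajor (σ h) x (mOf n h)

/-- `exp(2c (28 + max 0 (log (σ t)))) ≤ exp(56 c) σ^{2c}` for `σ ≥ 1`, `0 < t ≤ 1`, `c ∈ ℕ`. [folklore] -/
theorem exp_bound_le {c : ℕ} {σ t : ℝ} (hσ : 1 ≤ σ) (ht0 : 0 < t) (ht1 : t ≤ 1) :
    Real.exp (2 * c * (28 + max 0 (Real.log (σ * t)))) ≤ Real.exp (56 * c) * σ ^ (2 * c) := by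
  have hσ0 : 0 < σ := by linarith
  have hmax : max 0 (Real.log (σ * t)) ≤ Real.log σ := by
    refine max_le (Real.log_nonneg hσ) (Real.log_le_log (by positivity) ?_)
    calc σ * t ≤ σ * 1 := mul_le_mul_of_nonneg_left ht1 hσ0.le
      _ = σ := mul_one σ
  calc Real.exp (2 * c * (28 + max 0 (Real.log (σ * t)))) ≤ Real.exp (2 * c * (28 + Real.log σ)) :=
        Real.exp_le_exp.2 (mul_le_mul_of_nonneg_left (by linarith) (by positivity))
    _ = Real.exp (56 * c) * Real.exp (Real.log σ) ^ (2 * c) := by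
        rw [← Real.exp_nat_mul, ← Real.exp_add]; congr 1; push_cast; ring
    _ = Real.exp (56 * c) * σ ^ (2 * c) := by rw [Real.exp_log hσ0]

/-- **Step B (xnx).** The arithmetic bound: for `σ_h ≥ 1` and `x` large (as listed),
`arithQ ≤ K₁ ε x/(B^k W) ∏_h σ_h^N + c₂^k x^{11/20}`. [cite: Polymath8b2014, proof of Prop. 4.2, p. 15] -/
theorem arith_bound (hH : IsAdmissibleTuple H) (hk : 1 ≤ H.card) (hx3 : 3 ≤ x) (hxM : (shiftM H : ℝ) + 2 ≤ x)
    (hb : ∀ h ∈ H, Int.gcd (b + h) (polymathW x) = 1)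
    (hWp : ∀ p : ℕ, p.Prime → ¬ p ∣ polymathW x → 2 * H.card < p ∧ ∀ a ∈ H, ∀ c ∈ H, |a - c| < p)
    (hB : ∀ m : ℕ, (2 : ℝ) ^ m > Real.log x ∨ (3 ≤ x ^ (1 / (40 * (H.card : ℝ) * (m + 1))) ∧
      ∀ p ∈ (polymathW x).primeFactors, (p : ℝ) < x ^ (1 / (40 * (H.card : ℝ) * (m + 1)))))
    (hWc : ∀ p : ℕ, p.Prime → ¬ p ∣ polymathW x → 2 * cF H.card ≤ p)
    {ε : ℝ} (hε : 0 < ε) (hεy : x ^ ε < x ^ (1 / (40 * (H.card : ℝ)))) (hε2 : 2 ≤ x ^ ε) (hεlog : 1 / ε ≤ Real.log x)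
    {h₀ : ℤ} (hh₀ : h₀ ∈ H) (σ : ℤ → ℝ) (hσ : ∀ h ∈ H, 1 ≤ σ h) :
    arithQ H x b (x ^ ε) h₀ σ ≤ K₁ H.card * ε * (x / (polymathB x ^ H.card * polymathW x)) * ∏ h ∈ H, σ h ^ Nexp H.card +
      c2 H.card ^ H.card * x ^ (11 / 20 : ℝ) := by
  set k := H.card with hkdef
  set W := polymathW x with hW
  set y := x ^ (1 / (40 * (k : ℝ))) with hy
  set X₀ := x / (polymathB x ^ k * W) with hX₀
  set S := (polymathRange x b).filter (badN (x ^ ε) h₀) with hS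
  have hx0 : 0 < x := by linarith
  have hx1 : 1 ≤ x := by linarith
  have hxgt1 : 1 < x := by linarith
  have hy1 : 1 < y := Real.one_lt_rpow hxgt1 (by positivity)
  have hy2 : 2 ≤ y := hε2.trans hεy.le
  have hy0 : 0 ≤ y := by linarith
  have hc2 : 1 ≤ c2 k := one_le_c2 k
  have hcG0 : 0 ≤ cG k := by linarith [one_le_cG k]
  have hcF0 : 0 ≤ cF k := by linarith [one_le_cF k]
  have hσ0 : ∀ h ∈ H, 0 ≤ σ h := fun h hh => le_trans zero_le_one (hσ h hh)
  have hWcG : ∀ p : ℕ, p.Prime → ¬ p ∣ W → cG k ≤ p := fun p hp hpW => by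
    have := hWc p hp hpW; linarith [cG_le_cF k, one_le_cG k]
  have hX₀nn : 0 ≤ X₀ := by
    rw [hX₀]; refine div_nonneg hx0.le (mul_nonneg (pow_nonneg (polymathB_pos hxgt1).le _) (Nat.cast_nonneg _))
  let h₀' : ↥H := ⟨h₀, hh₀⟩
  -- Step B1: pointwise, through the smooth parts
  have hpt : ∀ n ∈ S, ∏ h ∈ H, (4 : ℝ) ^ ω (mOf n h) * eulerMajor (σ h) x (mOf n h) ≤
      c2 k ^ k * ∏ i : ↥H, Gw (cG k) (σ i) x (dvec H y n i) := by
    intro n hn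
    obtain ⟨hrange, -⟩ := Finset.mem_filter.1 hn
    rw [← Finset.prod_coe_sort H, show c2 k ^ k = ∏ _i : ↥H, c2 k by rw [Finset.prod_const, Finset.card_univ, Fintype.card_coe]]
    rw [← Finset.prod_mul_distrib]
    refine Finset.prod_le_prod (fun i _ => mul_nonneg (by positivity) (eulerMajor_nonneg (hσ0 i i.2) hx1 _)) fun i _ => ?_
    obtain ⟨-, -, hm0, hm3, -⟩ := mOf_facts hxM hb hrange i.2
    exact weight_le_smoothPart hk hx3 (hσ0 i i.2) hm0 hm3
  -- Step B2: group by the tuple of smooth parts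
  set img := S.image (dvec H y) with himg
  have hgrp : ∑ n ∈ S, ∏ i : ↥H, Gw (cG k) (σ i) x (dvec H y n i) =
      ∑ d ∈ img, ((S.filter fun n => dvec H y n = d).card : ℝ) * ∏ i : ↥H, Gw (cG k) (σ i) x (d i) := by
    have h := Finset.sum_comp (s := S) (fun d : ↥H → ℕ => ∏ i : ↥H, Gw (cG k) (σ i) x (d i)) (dvec H y)
    rw [himg, h]
    refine Finset.sum_congr rfl fun d _ => by rw [nsmul_eq_mul]
  -- Step B3: properties of the tuples in the image
  have himg_mem : ∀ d ∈ img, (∀ i, d i ∈ Dset W y) ∧ (∃ q : ℕ, q.Prime ∧ q ∣ d h₀' ∧ (q : ℝ) ≤ x ^ ε) := by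
    intro d hd
    obtain ⟨n, hn, rfl⟩ := Finset.mem_image.1 hd
    obtain ⟨hrange, hbad⟩ := Finset.mem_filter.1 hn
    refine ⟨fun i => ?_, ?_⟩
    · obtain ⟨-, -, hm0, -, hcop⟩ := mOf_facts hxM hb hrange i.2
      rw [mem_Dset]
      refine ⟨⟨smoothPart_pos y _, Nat.le_floor (smoothPart_lt hy1 _).le⟩, hcop.coprime_dvd_left (smoothPart_dvd y hm0)⟩
    · obtain ⟨p, hp, hpd, hpz⟩ := hbad
      obtain ⟨-, -, hm0, -, -⟩ := mOf_facts hxM hb hrange hh₀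
      exact exists_prime_dvd_smoothPart_of_dvd hεy hm0 hp hpd hpz
  -- Step B4: the count of each fibre
  have hfib : ∀ d ∈ img, ((S.filter fun n => dvec H y n = d).card : ℝ) ≤
      countConst k * 2 ^ ((k + 1) * Ω (∏ i : ↥H, d i)) * X₀ / ((∏ i : ↥H, d i : ℕ) : ℝ) + x ^ (1 / 2 : ℝ) := by
    intro d hd
    have hsub1 : S.filter (fun n => dvec H y n = d) ⊆ (polymathRange x b).filter (fun n => dvec H y n = d) :=
      Finset.filter_subset_filter _ (Finset.filter_subset _ _)
    have hsub2 := fiber_subset_cnt (H := H) (x := x) (b := b) hxM hb d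
    have hD : ∏ h ∈ H, extD H d h = ∏ i : ↥H, d i := by
      rw [← Finset.prod_coe_sort H]; exact Finset.prod_congr rfl fun i _ => extD_apply d i.2
    have hcnt := count_le hH hk hxM (b := b) (fun h hh => Int.isCoprime_iff_gcd_eq_one.2 (hb h hh)) hWp hB
      (d := extD H d) fun h hh => by rw [extD_apply d hh]; exact ((himg_mem d hd).1 ⟨h, hh⟩ |> mem_Dset.1).1.1
    rw [hD] at hcnt hsub2
    calc ((S.filter fun n => dvec H y n = d).card : ℝ) ≤ ((cnt H x b (extD H d) (x ^ (1 / (40 * (k : ℝ) * (Ω (∏ i : ↥H, d i) + 1))))).card : ℝ) := by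
          exact_mod_cast Finset.card_le_card (hsub1.trans hsub2)
      _ ≤ _ := hcnt
  -- Step B5: the per-tuple algebra `∏ G(d_i) · 2^{(k+1)Ω(D)}/D = ∏ F(d_i)`
  have halg : ∀ d ∈ img, (∏ i : ↥H, Gw (cG k) (σ i) x (d i)) * (2 ^ ((k + 1) * Ω (∏ i : ↥H, d i)) / ((∏ i : ↥H, d i : ℕ) : ℝ)) =
      ∏ i : ↥H, Fw (cF k) (σ i) x (d i) := by
    intro d hd
    have hd0 : ∀ i, d i ≠ 0 := fun i => by have := ((himg_mem d hd).1 i); rw [mem_Dset] at this; omega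
    rw [cardFactors_finset_prod _ fun i _ => hd0 i, Finset.mul_sum, ← Finset.prod_pow_eq_pow_sum, Nat.cast_prod,
      ← Finset.prod_div_distrib, ← Finset.prod_mul_distrib]
    exact Finset.prod_congr rfl fun i _ => Gw_mul_eq_Fw k (σ i) x (d i)
  -- Step B6: the Euler sums
  set E : ↥H → ℝ := fun i => ∑ e ∈ Dset W y, Fw (cF k) (σ i) x e with hE
  have hE0 : ∀ i, 0 ≤ E i := fun i => Finset.sum_nonneg fun e _ => Fw_nonneg hcF0 (hσ0 i i.2) hx1 e
  have hEle : ∀ i, E i ≤ Real.exp (56 * cF k) * σ i ^ (2 * cFn k) := by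
    intro i
    have h1 := sum_Fw_le (W := W) (y := y) hcF0 (hσ0 i i.2) hx1 hWc
    have h2 := sum_mw_div_le_log (hσ i i.2) (by linarith : (2 : ℝ) ≤ x) hy2
    have hlogx : Real.log x ≠ 0 := (Real.log_pos hxgt1).ne'
    have ht : Real.log y / Real.log x = 1 / (40 * k) := by
      rw [hy, Real.log_rpow hx0]; field_simp
    have h1k : (1 : ℝ) ≤ k := by exact_mod_cast hk
    have ht1 : 1 / (40 * (k : ℝ)) ≤ 1 := by rw [div_le_one (by positivity)]; linarith
    refine h1.trans ((Real.exp_le_exp.2 (mul_le_mul_of_nonneg_left h2 (by positivity))).trans ?_)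
    rw [show σ i * Real.log y / Real.log x = σ i * (Real.log y / Real.log x) by ring, ht, cF_eq]
    exact exp_bound_le (hσ i i.2) (by positivity) ht1
  have hbadle : ∑ e ∈ (Dset W y).filter (fun e => ∃ q : ℕ, q.Prime ∧ q ∣ e ∧ (q : ℝ) ≤ x ^ ε), Fw (cF k) (σ h₀) x e ≤
      58 * cF k * ε * σ h₀ * E h₀' := by
    have h1 := sum_Fw_bad_le (W := W) (y := y) hcF0 (hσ0 h₀ hh₀) hx1 hWc (x ^ ε)
    have h2 := sum_mw_div_le_lin (hσ h₀ hh₀) (by linarith : (2 : ℝ) ≤ x) hε2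
    rw [Real.log_rpow hx0] at h2
    have hlogx : 0 < Real.log x := Real.log_pos hxgt1
    have h3 : ∑ p ∈ Nat.primesLE ⌊x ^ ε⌋₊, mw (σ h₀) x p / p ≤ 29 * (σ h₀ * ε) := by
      have e1 : 27 * (σ h₀ * (ε * Real.log x) / Real.log x) = 27 * (σ h₀ * ε) := by field_simp
      have e2 : 2 * σ h₀ / Real.log x ≤ 2 * (σ h₀ * ε) := by
        rw [div_le_iff₀ hlogx]
        have : 1 ≤ ε * Real.log x := by rw [div_le_iff₀ hε] at hεlog; linarith
        nlinarith [hσ h₀ hh₀]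
      linarith
    refine h1.trans ?_
    have hσε : 0 ≤ σ h₀ * ε := by nlinarith [hσ h₀ hh₀]
    calc 2 * cF k * (∑ q ∈ Nat.primesLE ⌊x ^ ε⌋₊, mw (σ h₀) x q / q) * ∑ d ∈ Dset W y, Fw (cF k) (σ h₀) x d
        ≤ 2 * cF k * (29 * (σ h₀ * ε)) * E h₀' := by
          refine mul_le_mul_of_nonneg_right (mul_le_mul_of_nonneg_left h3 (by positivity)) (hE0 h₀')
      _ = 58 * cF k * ε * σ h₀ * E h₀' := by ring
  -- Step B7: the main sum over the tuples factorises
  set t : ↥H → Finset ℕ := fun i => if i = h₀' then (Dset W y).filter (fun e => ∃ q : ℕ, q.Prime ∧ q ∣ e ∧ (q : ℝ) ≤ x ^ ε) else Dset W y with ht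
  have himg_sub : img ⊆ Fintype.piFinset t := by
    intro d hd
    rw [Fintype.mem_piFinset]
    intro i
    by_cases hi : i = h₀'
    · subst hi; rw [ht]; simp only [if_true]
      exact Finset.mem_filter.2 ⟨(himg_mem d hd).1 _, (himg_mem d hd).2⟩
    · rw [ht]; simp only [hi, if_false]; exact (himg_mem d hd).1 i
  have hmain : ∑ d ∈ img, ∏ i : ↥H, Fw (cF k) (σ i) x (d i) ≤ 58 * cF k * ε * Real.exp (56 * cF k) ^ k * ∏ i : ↥H, σ i ^ Nexp k := by
    calc ∑ d ∈ img, ∏ i : ↥H, Fw (cF k) (σ i) x (d i) ≤ ∑ d ∈ Fintype.piFinset t, ∏ i : ↥H, Fw (cF k) (σ i) x (d i) :=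
          Finset.sum_le_sum_of_subset_of_nonneg himg_sub fun d _ _ => Finset.prod_nonneg fun i _ => Fw_nonneg hcF0 (hσ0 i i.2) hx1 _
      _ = ∏ i : ↥H, ∑ e ∈ t i, Fw (cF k) (σ i) x e := (Finset.prod_univ_sum t _).symm
      _ = (∑ e ∈ t h₀', Fw (cF k) (σ h₀) x e) * ∏ i ∈ Finset.univ.erase h₀', ∑ e ∈ t i, Fw (cF k) (σ i) x e :=
          (Finset.mul_prod_erase Finset.univ (fun i : ↥H => ∑ e ∈ t i, Fw (cF k) (σ i) x e) (Finset.mem_univ h₀')).symm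
      _ ≤ (58 * cF k * ε * σ h₀ * E h₀') * ∏ i ∈ Finset.univ.erase h₀', E i := by
          have ht0 : t h₀' = (Dset W y).filter (fun e => ∃ q : ℕ, q.Prime ∧ q ∣ e ∧ (q : ℝ) ≤ x ^ ε) := by rw [ht]; simp
          have hti : ∀ i ∈ Finset.univ.erase h₀', t i = Dset W y := fun i hi => by
            rw [ht]; simp [Finset.ne_of_mem_erase hi]
          rw [ht0, Finset.prod_congr rfl fun i hi => by rw [hti i hi]]
          exact mul_le_mul_of_nonneg_right hbadle (Finset.prod_nonneg fun i _ => hE0 i)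
      _ = 58 * cF k * ε * σ h₀ * ∏ i : ↥H, E i := by rw [mul_assoc, Finset.mul_prod_erase _ _ (Finset.mem_univ h₀')]
      _ ≤ 58 * cF k * ε * σ h₀ * ∏ i : ↥H, (Real.exp (56 * cF k) * σ i ^ (2 * cFn k)) := by
          refine mul_le_mul_of_nonneg_left (Finset.prod_le_prod (fun i _ => hE0 i) fun i _ => hEle i) ?_
          have := hσ h₀ hh₀; positivity
      _ = 58 * cF k * ε * Real.exp (56 * cF k) ^ k * (σ h₀ * ∏ i : ↥H, σ i ^ (2 * cFn k)) := by
          rw [Finset.prod_mul_distrib, Finset.prod_const, Finset.card_univ, Fintype.card_coe]; ring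
      _ ≤ 58 * cF k * ε * Real.exp (56 * cF k) ^ k * ∏ i : ↥H, σ i ^ Nexp k := by
          refine mul_le_mul_of_nonneg_left ?_ (by positivity)
          -- `σ_{h₀} ∏ σ_i^{2c} ≤ ∏ σ_i^{2c+1}`
          have hprod1 : σ h₀ ≤ ∏ i : ↥H, σ i := by
            rw [← Finset.mul_prod_erase _ _ (Finset.mem_univ h₀')]
            refine le_mul_of_one_le_right (hσ0 h₀ hh₀) (Finset.one_le_prod fun i _ => hσ i i.2)
          calc σ h₀ * ∏ i : ↥H, σ i ^ (2 * cFn k) ≤ (∏ i : ↥H, σ i) * ∏ i : ↥H, σ i ^ (2 * cFn k) :=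
                mul_le_mul_of_nonneg_right hprod1 (Finset.prod_nonneg fun i _ => pow_nonneg (hσ0 i i.2) _)
            _ = ∏ i : ↥H, σ i ^ Nexp k := by
                rw [← Finset.prod_mul_distrib]; exact Finset.prod_congr rfl fun i _ => by rw [Nexp, pow_succ]; ring
  -- Step B8: the remainder sum
  have hrem : ∑ d ∈ img, ∏ i : ↥H, Gw (cG k) (σ i) x (d i) ≤ x ^ (1 / 20 : ℝ) := by
    have hsub : img ⊆ Fintype.piFinset fun _ : ↥H => Dset W y := fun d hd => Fintype.mem_piFinset.2 fun i => (himg_mem d hd).1 i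
    calc ∑ d ∈ img, ∏ i : ↥H, Gw (cG k) (σ i) x (d i) ≤ ∑ d ∈ Fintype.piFinset (fun _ : ↥H => Dset W y), ∏ i : ↥H, Gw (cG k) (σ i) x (d i) :=
          Finset.sum_le_sum_of_subset_of_nonneg hsub fun d _ _ => Finset.prod_nonneg fun i _ => Gw_nonneg hcG0 (hσ0 i i.2) hx1 _
      _ = ∏ i : ↥H, ∑ e ∈ Dset W y, Gw (cG k) (σ i) x e := Finset.sum_prod_piFinset _ _
      _ ≤ ∏ _i : ↥H, y ^ 2 := Finset.prod_le_prod (fun i _ => Finset.sum_nonneg fun e _ => Gw_nonneg hcG0 (hσ0 i i.2) hx1 e)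
          fun i _ => sum_Gw_le hcG0 (hσ0 i i.2) hx1 hy0 hWcG
      _ = x ^ (1 / 20 : ℝ) := by
          rw [Finset.prod_const, Finset.card_univ, Fintype.card_coe, ← hkdef, hy, ← Real.rpow_natCast, ← Real.rpow_natCast,
            ← Real.rpow_mul hx0.le, ← Real.rpow_mul hx0.le]
          congr 1
          have : (k : ℝ) ≠ 0 := (lt_of_lt_of_le zero_lt_one (by exact_mod_cast hk : (1 : ℝ) ≤ k)).ne'
          push_cast; field_simp; ring
  -- Step B9: assemble
  have hC0 : 0 ≤ countConst k := by linarith [two_le_countConst k]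
  calc arithQ H x b (x ^ ε) h₀ σ ≤ ∑ n ∈ S, c2 k ^ k * ∏ i : ↥H, Gw (cG k) (σ i) x (dvec H y n i) := Finset.sum_le_sum hpt
    _ = c2 k ^ k * ∑ d ∈ img, ((S.filter fun n => dvec H y n = d).card : ℝ) * ∏ i : ↥H, Gw (cG k) (σ i) x (d i) := by
        rw [← Finset.mul_sum, hgrp]
    _ ≤ c2 k ^ k * ∑ d ∈ img, (countConst k * 2 ^ ((k + 1) * Ω (∏ i : ↥H, d i)) * X₀ / ((∏ i : ↥H, d i : ℕ) : ℝ) + x ^ (1 / 2 : ℝ)) *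
          ∏ i : ↥H, Gw (cG k) (σ i) x (d i) := by
        refine mul_le_mul_of_nonneg_left (Finset.sum_le_sum fun d hd => mul_le_mul_of_nonneg_right (hfib d hd)
          (Finset.prod_nonneg fun i _ => Gw_nonneg hcG0 (hσ0 i i.2) hx1 _)) (by positivity)
    _ = c2 k ^ k * (countConst k * X₀ * ∑ d ∈ img, ∏ i : ↥H, Fw (cF k) (σ i) x (d i) +
          x ^ (1 / 2 : ℝ) * ∑ d ∈ img, ∏ i : ↥H, Gw (cG k) (σ i) x (d i)) := by
        congr 1
        rw [Finset.mul_sum, Finset.mul_sum, ← Finset.sum_add_distrib]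
        refine Finset.sum_congr rfl fun d hd => ?_
        rw [← halg d hd]; ring
    _ ≤ c2 k ^ k * (countConst k * X₀ * (58 * cF k * ε * Real.exp (56 * cF k) ^ k * ∏ i : ↥H, σ i ^ Nexp k) +
          x ^ (1 / 2 : ℝ) * x ^ (1 / 20 : ℝ)) := by
        refine mul_le_mul_of_nonneg_left (add_le_add (mul_le_mul_of_nonneg_left hmain (by positivity))
          (mul_le_mul_of_nonneg_left hrem (by positivity))) (by positivity)
    _ = K₁ k * ε * X₀ * ∏ h ∈ H, σ h ^ Nexp k + c2 k ^ k * x ^ (11 / 20 : ℝ) := by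
        rw [← Real.rpow_add hx0, Finset.prod_coe_sort H (fun h => σ h ^ Nexp k), K₁]; norm_num; ring

end StepB

/-! ### Step C: the Fourier induction over the shifts -/

section StepC

variable {H : Finset ℤ} {x : ℝ} {b : ℤ}

/-- The mixed sum: Euler-product weights on `H ∖ T`, squares of divisor sums on `T`.
[cite: Polymath8b2014, proof of Prop. 4.2, p. 15] -/
def mixQ (H T : Finset ℤ) (x : ℝ) (b : ℤ) (z : ℝ) (h₀ : ℤ) (E : ℤ → ℝ → ℝ) (σ : ℤ → ℝ) : ℝ :=
  ∑ n ∈ (polymathRange x b).filter (badN z h₀),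
    (∏ h ∈ H \ T, (4 : ℝ) ^ ω (mOf n h) * eulerMajor (σ h) x (mOf n h)) * ∏ h ∈ T, divisorSumWeight (E h) x (mOf n h) ^ 2

/-- `mixQ` with `T = ∅` is `arithQ`. [folklore] -/
theorem mixQ_empty (H : Finset ℤ) (x : ℝ) (b : ℤ) (z : ℝ) (h₀ : ℤ) (E : ℤ → ℝ → ℝ) (σ : ℤ → ℝ) :
    mixQ H ∅ x b z h₀ E σ = arithQ H x b z h₀ σ := by
  simp [mixQ, arithQ]

/-- The `σ`-moment of the Fourier weight: `M_h = ‖f_h‖₁ ∫ |f_h(ξ)| (1 + 2π|ξ|)^N dξ`. [folklore] -/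
def Mh {F : ℝ → ℝ} {s : ℝ} (hF : IsSieveCutoff F s) (N : ℕ) : ℝ :=
  fourierL1 hF * ∫ ξ : ℝ, ‖hF.fourierWeight ξ‖ * (1 + 2 * π * |ξ|) ^ N

/-- `(1 + 2π|ξ|)^N |f(ξ)|` is integrable. [folklore] -/
theorem integrable_sigma_pow {F : ℝ → ℝ} {s : ℝ} (hF : IsSieveCutoff F s) (N : ℕ) :
    Integrable fun ξ : ℝ => ‖hF.fourierWeight ξ‖ * (1 + 2 * π * |ξ|) ^ N := by
  have h := (hF.integrable_pow_mul_norm_fourierWeight N).const_mul ((2 * π) ^ N)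
  refine h.mono' ((hF.continuous_fourierWeight.norm.mul (by fun_prop)).aestronglyMeasurable) (Eventually.of_forall fun ξ => ?_)
  have hπ : (1 : ℝ) ≤ 2 * π := by linarith [Real.pi_gt_three]
  have h1 : 1 + 2 * π * |ξ| ≤ 2 * π * (1 + |ξ|) := by nlinarith [abs_nonneg ξ]
  rw [Real.norm_of_nonneg (by positivity)]
  calc ‖hF.fourierWeight ξ‖ * (1 + 2 * π * |ξ|) ^ N ≤ ‖hF.fourierWeight ξ‖ * (2 * π * (1 + |ξ|)) ^ N :=
        mul_le_mul_of_nonneg_left (pow_le_pow_left₀ (by positivity) h1 N) (norm_nonneg _)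
    _ = (2 * π) ^ N * ((1 + |ξ|) ^ N * ‖hF.fourierWeight ξ‖) := by rw [mul_pow]; ring

/-- `0 ≤ M_h`. [folklore] -/
theorem Mh_nonneg {F : ℝ → ℝ} {s : ℝ} (hF : IsSieveCutoff F s) (N : ℕ) : 0 ≤ Mh hF N :=
  mul_nonneg (fourierL1_nonneg hF) (integral_nonneg fun ξ => by positivity)

/-- **Step C.** The Fourier induction: for `T ⊆ H` and `σ_h ≥ 1` on `H ∖ T`,
`mixQ T σ ≤ (K₁ ε X₀ ∏_{H∖T} σ_h^N + c₂^k x^{11/20}) ∏_{h ∈ T} M_h`, given the arithmetic bound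
for all `σ ≥ 1`. [cite: Polymath8b2014, proof of Prop. 4.2, p. 15] -/
theorem fourier_induction (hx1 : 1 < x) (hxM : (shiftM H : ℝ) + 2 ≤ x) (hb : ∀ h ∈ H, Int.gcd (b + h) (polymathW x) = 1)
    {z A R : ℝ} (hR : 0 ≤ R) {h₀ : ℤ} {N : ℕ}
    (harith : ∀ σ : ℤ → ℝ, (∀ h ∈ H, 1 ≤ σ h) → arithQ H x b z h₀ σ ≤ A * ∏ h ∈ H, σ h ^ N + R)
    (E : ℤ → ℝ → ℝ) (sE : ℤ → ℝ) (hE : ∀ h ∈ H, IsSieveCutoff (E h) (sE h))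
    {T : Finset ℤ} (hT : T ⊆ H) (σ : ℤ → ℝ) (hσ : ∀ h ∈ H \ T, 1 ≤ σ h) :
    mixQ H T x b z h₀ E σ ≤ (A * ∏ h ∈ H \ T, σ h ^ N + R) * ∏ h ∈ T.attach, Mh (hE h (hT h.2)) N := by
  induction T using Finset.induction_on generalizing σ with
  | empty =>
    rw [mixQ_empty, Finset.attach_empty, Finset.prod_empty, mul_one, Finset.sdiff_empty]
    exact harith σ (by simpa using hσ)
  | insert a T haT ih =>
    have haH : a ∈ H := hT (Finset.mem_insert_self a T)
    have hTH : T ⊆ H := fun h hh => hT (Finset.mem_insert_of_mem hh)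
    have hEa := hE a haH
    set S := (polymathRange x b).filter (badN z h₀) with hS
    set σξ : ℝ → ℝ := fun ξ => 1 + 2 * π * |ξ| with hσξ
    have hσξ1 : ∀ ξ, 1 ≤ σξ ξ := fun ξ => by
      have : 0 ≤ 2 * π * |ξ| := by positivity
      simp only [hσξ]; linarith
    -- the two products, for each `n`
    set Af : ℕ → ℝ := fun n => ∏ h ∈ H \ insert a T, (4 : ℝ) ^ ω (mOf n h) * eulerMajor (σ h) x (mOf n h) with hAf
    set Bf : ℕ → ℝ := fun n => ∏ h ∈ T, divisorSumWeight (E h) x (mOf n h) ^ 2 with hBf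
    have hAf0 : ∀ n, 0 ≤ Af n := fun n => Finset.prod_nonneg fun h hh => mul_nonneg (by positivity)
      (eulerMajor_nonneg (le_trans zero_le_one (hσ h (by
        rw [Finset.mem_sdiff] at hh ⊢; exact ⟨hh.1, hh.2⟩))) hx1.le _)
    have hBf0 : ∀ n, 0 ≤ Bf n := fun n => Finset.prod_nonneg fun h _ => sq_nonneg _
    -- Step 1: the term at `n`, with `λ_a²` majorised
    have hsdiff : H \ T = insert a (H \ insert a T) := by
      ext h
      simp only [Finset.mem_sdiff, Finset.mem_insert]
      constructor
      · rintro ⟨hh, hnT⟩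
        by_cases hha : h = a
        · exact Or.inl hha
        · exact Or.inr ⟨hh, fun h' => h'.elim hha hnT⟩
      · rintro (rfl | ⟨hh, hn⟩)
        · exact ⟨haH, haT⟩
        · exact ⟨hh, fun h' => hn (Or.inr h')⟩
    have ha_notin : a ∉ H \ insert a T := by simp
    -- the integrand after majorisation
    set g : ℕ → ℝ → ℝ := fun n ξ => ‖hEa.fourierWeight ξ‖ *
      ((Af n * ((4 : ℝ) ^ ω (mOf n a) * eulerMajor (σξ ξ) x (mOf n a))) * Bf n) with hg
    have hterm : ∀ n ∈ S, (∏ h ∈ H \ insert a T, (4 : ℝ) ^ ω (mOf n h) * eulerMajor (σ h) x (mOf n h)) *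
        ∏ h ∈ insert a T, divisorSumWeight (E h) x (mOf n h) ^ 2 ≤ fourierL1 hEa * ∫ ξ : ℝ, g n ξ := by
      intro n hn
      obtain ⟨hrange, -⟩ := Finset.mem_filter.1 hn
      obtain ⟨-, -, hm0, -, -⟩ := mOf_facts hxM hb hrange haH
      rw [Finset.prod_insert haT]
      have hsq := sq_divisorSumWeight_le hEa hx1 hm0
      have hI : ∫ ξ : ℝ, g n ξ = (Af n * (4 : ℝ) ^ ω (mOf n a) * Bf n) *
          ∫ ξ : ℝ, ‖hEa.fourierWeight ξ‖ * eulerMajor (1 + 2 * π * |ξ|) x (mOf n a) := by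
        rw [← integral_const_mul]
        refine integral_congr_ae (Eventually.of_forall fun ξ => ?_)
        simp only [hg, hσξ]; ring
      rw [hI]
      calc Af n * (divisorSumWeight (E a) x (mOf n a) ^ 2 * Bf n)
          ≤ Af n * ((4 ^ ω (mOf n a) * fourierL1 hEa * ∫ ξ : ℝ, ‖hEa.fourierWeight ξ‖ * eulerMajor (1 + 2 * π * |ξ|) x (mOf n a)) * Bf n) :=
            mul_le_mul_of_nonneg_left (mul_le_mul_of_nonneg_right hsq (hBf0 n)) (hAf0 n)
        _ = fourierL1 hEa * ((Af n * (4 : ℝ) ^ ω (mOf n a) * Bf n) *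
            ∫ ξ : ℝ, ‖hEa.fourierWeight ξ‖ * eulerMajor (1 + 2 * π * |ξ|) x (mOf n a)) := by ring
    -- Step 2: integrability of each `g n`
    have hgint : ∀ n ∈ S, Integrable (g n) := by
      intro n _
      have h := (integrable_majorant hEa hx1.le (mOf n a)).const_mul (Af n * (4 : ℝ) ^ ω (mOf n a) * Bf n)
      refine h.congr (Eventually.of_forall fun ξ => ?_)
      simp only [hg, hσξ]; ring
    -- Step 3: sum over `n` and exchange
    have hsum : mixQ H (insert a T) x b z h₀ E σ ≤ fourierL1 hEa * ∫ ξ : ℝ, ∑ n ∈ S, g n ξ := by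
      rw [integral_finsetSum _ hgint, Finset.mul_sum]
      exact Finset.sum_le_sum hterm
    -- Step 4: the inner sum is `|f_a(ξ)| · mixQ T (σ[a ↦ σ_ξ])`
    have hinner : ∀ ξ, ∑ n ∈ S, g n ξ = ‖hEa.fourierWeight ξ‖ * mixQ H T x b z h₀ E (Function.update σ a (σξ ξ)) := by
      intro ξ
      rw [mixQ, Finset.mul_sum]
      refine Finset.sum_congr rfl fun n _ => ?_
      simp only [hg]
      congr 1
      rw [hsdiff, Finset.prod_insert ha_notin, Function.update_self]
      have hA' : ∏ h ∈ H \ insert a T, (4 : ℝ) ^ ω (mOf n h) * eulerMajor (Function.update σ a (σξ ξ) h) x (mOf n h) = Af n := by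
        refine Finset.prod_congr rfl fun h hh => ?_
        have hha : h ≠ a := fun e => by rw [e] at hh; exact ha_notin hh
        rw [Function.update_of_ne hha]
      rw [hA']; ring
    -- Step 5: the induction hypothesis inside the integral
    set P := ∏ h ∈ H \ insert a T, σ h ^ N with hP
    set MT := ∏ h ∈ T.attach, Mh (hE h (hTH h.2)) N with hMT
    have hP0 : 0 ≤ P := Finset.prod_nonneg fun h hh => pow_nonneg (le_trans zero_le_one (hσ h (by
      rw [Finset.mem_sdiff] at hh ⊢; exact ⟨hh.1, hh.2⟩))) _
    have hMT0 : 0 ≤ MT := Finset.prod_nonneg fun h _ => Mh_nonneg _ _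
    have hIH : ∀ ξ, mixQ H T x b z h₀ E (Function.update σ a (σξ ξ)) ≤ (A * (σξ ξ ^ N * P) + R) * MT := by
      intro ξ
      have h := ih hTH (Function.update σ a (σξ ξ)) fun h hh => by
        by_cases hha : h = a
        · subst hha; rw [Function.update_self]; exact hσξ1 ξ
        · rw [Function.update_of_ne hha]
          rw [Finset.mem_sdiff] at hh
          exact hσ h (Finset.mem_sdiff.2 ⟨hh.1, fun h' => (Finset.mem_insert.1 h').elim hha hh.2⟩)
      have hprod : ∏ h ∈ H \ T, Function.update σ a (σξ ξ) h ^ N = σξ ξ ^ N * P := by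
        rw [hsdiff, Finset.prod_insert ha_notin, Function.update_self, hP]
        congr 1
        refine Finset.prod_congr rfl fun h hh => ?_
        have hha : h ≠ a := fun e => by rw [e] at hh; exact ha_notin hh
        rw [Function.update_of_ne hha]
      rwa [hprod] at h
    -- Step 6: integrate the bound
    have hupper_int : Integrable fun ξ : ℝ => ‖hEa.fourierWeight ξ‖ * ((A * (σξ ξ ^ N * P) + R) * MT) := by
      have h1 := (integrable_sigma_pow hEa N).const_mul (A * P * MT)
      have h2 := hEa.integrable_fourierWeight.norm.const_mul (R * MT)
      refine (h1.add h2).congr (Eventually.of_forall fun ξ => ?_)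
      simp only [Pi.add_apply, hσξ]; ring
    have hmono : ∫ ξ : ℝ, ∑ n ∈ S, g n ξ ≤ ∫ ξ : ℝ, ‖hEa.fourierWeight ξ‖ * ((A * (σξ ξ ^ N * P) + R) * MT) := by
      refine integral_mono_of_nonneg (Eventually.of_forall fun ξ => ?_) hupper_int (Eventually.of_forall fun ξ => ?_)
      · exact Finset.sum_nonneg fun n _ => by
          simp only [hg]
          exact mul_nonneg (norm_nonneg _) (mul_nonneg (mul_nonneg (hAf0 n) (mul_nonneg (by positivity)
            (eulerMajor_nonneg (by linarith [hσξ1 ξ]) hx1.le _))) (hBf0 n))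
      · simp only
        rw [hinner ξ]
        exact mul_le_mul_of_nonneg_left (hIH ξ) (norm_nonneg _)
    -- Step 7: evaluate and simplify the upper integral
    have heval : ∫ ξ : ℝ, ‖hEa.fourierWeight ξ‖ * ((A * (σξ ξ ^ N * P) + R) * MT) =
        (A * P * MT) * (∫ ξ : ℝ, ‖hEa.fourierWeight ξ‖ * σξ ξ ^ N) + (R * MT) * (∫ ξ : ℝ, ‖hEa.fourierWeight ξ‖) := by
      rw [← integral_const_mul, ← integral_const_mul, ← integral_add ((integrable_sigma_pow hEa N).const_mul _)
        (hEa.integrable_fourierWeight.norm.const_mul _)]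
      refine integral_congr_ae (Eventually.of_forall fun ξ => ?_)
      simp only [hσξ]; ring
    have hL1le : ∫ ξ : ℝ, ‖hEa.fourierWeight ξ‖ ≤ ∫ ξ : ℝ, ‖hEa.fourierWeight ξ‖ * σξ ξ ^ N :=
      integral_mono_of_nonneg (Eventually.of_forall fun ξ => norm_nonneg _) (integrable_sigma_pow hEa N)
        (Eventually.of_forall fun ξ => le_mul_of_one_le_right (norm_nonneg _) (one_le_pow₀ (hσξ1 ξ)))
    have hI0 : 0 ≤ ∫ ξ : ℝ, ‖hEa.fourierWeight ξ‖ * σξ ξ ^ N := integral_nonneg fun ξ => by positivity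
    -- Step 8: conclude
    have hattach : ∏ h ∈ (insert a T).attach, Mh (hE h (hT h.2)) N = Mh hEa N * MT := by
      rw [Finset.attach_insert, Finset.prod_insert]
      · congr 1
        rw [hMT, Finset.prod_image fun h _ h' _ heq => by exact Subtype.ext (by simpa using congrArg Subtype.val heq)]
      · simp only [Finset.mem_image, not_exists, not_and]
        intro h _ heq
        apply haT
        have := congrArg Subtype.val heq
        simp at this
        rw [← this]; exact h.2
    rw [hattach]
    have hMh : Mh hEa N = fourierL1 hEa * ∫ ξ : ℝ, ‖hEa.fourierWeight ξ‖ * σξ ξ ^ N := rfl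
    have hRMT : 0 ≤ R * MT := mul_nonneg hR hMT0
    calc mixQ H (insert a T) x b z h₀ E σ ≤ fourierL1 hEa * ∫ ξ : ℝ, ∑ n ∈ S, g n ξ := hsum
      _ ≤ fourierL1 hEa * ((A * P * MT) * (∫ ξ : ℝ, ‖hEa.fourierWeight ξ‖ * σξ ξ ^ N) + (R * MT) * (∫ ξ : ℝ, ‖hEa.fourierWeight ξ‖)) := by
          rw [← heval]; exact mul_le_mul_of_nonneg_left hmono (fourierL1_nonneg hEa)
      _ ≤ fourierL1 hEa * ((A * P * MT) * (∫ ξ : ℝ, ‖hEa.fourierWeight ξ‖ * σξ ξ ^ N) + (R * MT) * (∫ ξ : ℝ, ‖hEa.fourierWeight ξ‖ * σξ ξ ^ N)) := by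
          have h := mul_le_mul_of_nonneg_left hL1le hRMT
          exact mul_le_mul_of_nonneg_left (by linarith) (fourierL1_nonneg hEa)
      _ = (A * P + R) * (Mh hEa N * MT) := by rw [hMh]; ring

end StepC

/-! ### Step D: the hypotheses hold for large `x` -/

section StepD

/-- Primes not dividing `W` exceed `⌊w⌋`. [folklore] -/
theorem floor_lt_of_not_dvd_polymathW {x : ℝ} {p : ℕ} (hp : p.Prime) (h : ¬ p ∣ polymathW x) : ⌊polymathw x⌋₊ < p := by
  by_contra hle
  push Not at hle
  exact h ((Nat.Prime.dvd_primorial_iff hp).2 hle)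

/-- Prime factors of `W` are `≤ ⌊w⌋`. [folklore] -/
theorem le_floor_of_mem_primeFactors_polymathW {x : ℝ} {p : ℕ} (h : p ∈ (polymathW x).primeFactors) : p ≤ ⌊polymathw x⌋₊ :=
  (Nat.Prime.dvd_primorial_iff (Nat.prime_of_mem_primeFactors h)).1 (Nat.dvd_of_mem_primeFactors h)

/-- `C (log log x)² ≤ log x` eventually. [folklore] -/
theorem eventually_loglog_sq_le (C : ℝ) : ∀ᶠ x : ℝ in atTop, C * Real.log (Real.log x) ^ 2 ≤ Real.log x := by
  have h : ∀ᶠ u : ℝ in atTop, C * Real.log u ^ 2 ≤ u := by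
    have h1 := (Real.isLittleO_pow_log_id_atTop (n := 2)).const_mul_left C
    have h2 := h1.def zero_lt_one
    filter_upwards [h2, eventually_ge_atTop (1 : ℝ)] with u hu hu1
    rw [one_mul, id, Real.norm_eq_abs, Real.norm_eq_abs, abs_of_nonneg (by linarith : (0 : ℝ) ≤ u)] at hu
    exact le_trans (le_abs_self _) hu
  exact Real.tendsto_log_atTop.eventually h

/-- **Step D.** All the largeness hypotheses hold eventually (for fixed `0 < ε < 1/40k`). [folklore] -/
theorem eventually_hyps (H : Finset ℤ) (hk : 1 ≤ H.card) {ε : ℝ} (hε : 0 < ε) (hε1 : ε < 1 / (40 * (H.card : ℝ))) :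
    ∀ᶠ x : ℝ in atTop, 3 ≤ x ∧ (shiftM H : ℝ) + 2 ≤ x ∧
      (∀ p : ℕ, p.Prime → ¬ p ∣ polymathW x → 2 * H.card < p ∧ ∀ a ∈ H, ∀ c ∈ H, |a - c| < p) ∧
      (∀ m : ℕ, (2 : ℝ) ^ m > Real.log x ∨ (3 ≤ x ^ (1 / (40 * (H.card : ℝ) * (m + 1))) ∧
        ∀ p ∈ (polymathW x).primeFactors, (p : ℝ) < x ^ (1 / (40 * (H.card : ℝ) * (m + 1))))) ∧
      (∀ p : ℕ, p.Prime → ¬ p ∣ polymathW x → 2 * cF H.card ≤ p) ∧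
      x ^ ε < x ^ (1 / (40 * (H.card : ℝ))) ∧ 2 ≤ x ^ ε ∧ 1 / ε ≤ Real.log x ∧
      c2 H.card ^ H.card * x ^ (11 / 20 : ℝ) ≤ ε * (x / (polymathB x ^ H.card * polymathW x)) := by
  set k := H.card with hk'
  set M := shiftM H with hM
  have hk1 : (1 : ℝ) ≤ k := by exact_mod_cast hk
  -- the threshold for `⌊w⌋`
  set Q : ℕ := 2 * k + 2 * M + ⌈2 * cF k⌉₊ with hQ
  have hw := tendsto_polymathw_atTop.eventually_ge_atTop ((Q : ℝ) + 1)
  have hll := (Real.tendsto_log_atTop.comp Real.tendsto_log_atTop).eventually_ge_atTop (1 : ℝ)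
  have hB' := eventually_loglog_sq_le (360 * k)
  have hWlog := eventually_polymathW_le_log_sq
  have hc2pos : 0 < c2 k ^ k := by have := one_le_c2 k; positivity
  have hcpos : 0 < ε / c2 k ^ k := div_pos hε hc2pos
  have hpow : ∀ᶠ x : ℝ in atTop, Real.log x ^ (k + 2) ≤ ε / c2 k ^ k * x ^ (9 / 20 : ℝ) := by
    have h := (isLittleO_log_rpow_rpow_atTop ((k : ℝ) + 2) (by norm_num : (0 : ℝ) < 9 / 20)).def hcpos
    filter_upwards [h, eventually_ge_atTop (1 : ℝ)] with x hx hx1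
    rw [Real.norm_of_nonneg (Real.rpow_nonneg (Real.log_nonneg hx1) _), Real.norm_of_nonneg (Real.rpow_nonneg (by linarith) _)] at hx
    have e : (k : ℝ) + 2 = ((k + 2 : ℕ) : ℝ) := by push_cast; ring
    rwa [e, Real.rpow_natCast] at hx
  filter_upwards [eventually_ge_atTop (3 : ℝ), eventually_ge_atTop ((M : ℝ) + 2), hw, hll, hB', hWlog,
    (tendsto_rpow_atTop hε).eventually_ge_atTop 2, Real.tendsto_log_atTop.eventually_ge_atTop (1 / ε), hpow]
    with x hx3 hxM hwQ hllx hBx hWx hxε hlogε hpowx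
  have hx0 : 0 < x := by linarith
  have hx1 : 1 < x := by linarith
  have hlogx : 0 < Real.log x := Real.log_pos hx1
  have hllx' : 1 ≤ Real.log (Real.log x) := hllx
  have hw0 : 0 ≤ polymathw x := le_trans (by positivity) hwQ
  have hfloor : Q ≤ ⌊polymathw x⌋₊ := Nat.le_floor (by linarith)
  have hprime : ∀ p : ℕ, p.Prime → ¬ p ∣ polymathW x → Q < p := fun p hp h =>
    lt_of_le_of_lt hfloor (floor_lt_of_not_dvd_polymathW hp h)
  refine ⟨hx3, hxM, fun p hp h => ?_, fun m => ?_, fun p hp h => ?_, ?_, hxε, hlogε, ?_⟩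
  · have hQp := hprime p hp h
    refine ⟨by omega, fun a ha c hc => ?_⟩
    have h1 : |a| ≤ M := by rw [Int.abs_eq_natAbs]; exact_mod_cast natAbs_le_shiftM ha
    have h2 : |c| ≤ M := by rw [Int.abs_eq_natAbs]; exact_mod_cast natAbs_le_shiftM hc
    have h3 : |a - c| ≤ 2 * M := by
      have := abs_sub a c; linarith
    have h4 : ((2 * M : ℕ) : ℤ) < p := by exact_mod_cast (show 2 * M < p by omega)
    push_cast at h4; linarith
  · -- the sieve-level hypothesis
    by_cases hm : (2 : ℝ) ^ m > Real.log x
    · exact Or.inl hm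
    · right
      push Not at hm
      set t := x ^ (1 / (40 * (k : ℝ) * (m + 1))) with ht
      -- `m + 1 ≤ 3 log log x`
      have hm1 : (m : ℝ) + 1 ≤ 3 * Real.log (Real.log x) := by
        have h1 : (m : ℝ) * Real.log 2 ≤ Real.log (Real.log x) := by
          rw [← Real.log_pow]; exact Real.log_le_log (by positivity) hm
        have h2 : (0.6931471803 : ℝ) < Real.log 2 := Real.log_two_gt_d9
        nlinarith
      -- `log (w + 3) ≤ log log x + 2`
      have hw3 : Real.log (polymathw x + 3) ≤ Real.log (Real.log x) + 2 := by
        have h1 : Real.log (polymathw x + 3) ≤ polymathw x + 3 - 1 := Real.log_le_sub_one_of_pos (by linarith)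
        have h2 : polymathw x ≤ Real.log (Real.log x) - 1 := by
          rw [polymathw]; exact Real.log_le_sub_one_of_pos (by linarith)
        linarith
      -- hence `40k (m+1) log(w+3) ≤ 360 k (log log x)² ≤ log x`
      have hkey : 40 * k * ((m : ℝ) + 1) * Real.log (polymathw x + 3) ≤ Real.log x := by
        have hl3 : 0 ≤ Real.log (polymathw x + 3) := Real.log_nonneg (by linarith)
        calc 40 * k * ((m : ℝ) + 1) * Real.log (polymathw x + 3) ≤ 40 * k * (3 * Real.log (Real.log x)) * (Real.log (Real.log x) + 2) := by
              refine mul_le_mul (mul_le_mul_of_nonneg_left hm1 (by positivity)) hw3 hl3 (by positivity)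
          _ ≤ 40 * k * (3 * Real.log (Real.log x)) * (3 * Real.log (Real.log x)) := by
              refine mul_le_mul_of_nonneg_left (by linarith) (by positivity)
          _ = 360 * k * Real.log (Real.log x) ^ 2 := by ring
          _ ≤ Real.log x := hBx
      have ht3 : polymathw x + 3 ≤ t := by
        rw [ht, Real.le_rpow_iff_log_le (by linarith) hx0, one_div, le_inv_mul_iff₀ (by positivity)]
        linarith [hkey]
      refine ⟨by linarith, fun p hp => ?_⟩
      have h1 : (p : ℝ) ≤ ⌊polymathw x⌋₊ := by exact_mod_cast le_floor_of_mem_primeFactors_polymathW hp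
      have h2 : (⌊polymathw x⌋₊ : ℝ) ≤ polymathw x := Nat.floor_le hw0
      linarith
  · have := hprime p hp h
    have h1 : (⌈2 * cF k⌉₊ : ℝ) < p := by exact_mod_cast (show ⌈2 * cF k⌉₊ < p by omega)
    exact le_trans (Nat.le_ceil _) h1.le
  · exact Real.rpow_lt_rpow_of_exponent_lt hx1 hε1
  · -- `c₂^k x^{11/20} ≤ ε x/(B^k W)`
    have hB : polymathB x ≤ Real.log x := polymathB_le_log hx1.le
    have hBpos : 0 < polymathB x := polymathB_pos hx1
    have hWpos : (0 : ℝ) < polymathW x := by exact_mod_cast polymathW_pos x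
    have hden : polymathB x ^ k * polymathW x ≤ Real.log x ^ (k + 2) := by
      rw [pow_add]; exact mul_le_mul (pow_le_pow_left₀ hBpos.le hB k) hWx hWpos.le (by positivity)
    have hlogpow : 0 < Real.log x ^ (k + 2) := by positivity
    have h1 : c2 k ^ k * x ^ (11 / 20 : ℝ) * Real.log x ^ (k + 2) ≤ ε * x := by
      have hxsplit : x ^ (11 / 20 : ℝ) * x ^ (9 / 20 : ℝ) = x := by
        rw [← Real.rpow_add hx0]; norm_num
      calc c2 k ^ k * x ^ (11 / 20 : ℝ) * Real.log x ^ (k + 2) ≤ c2 k ^ k * x ^ (11 / 20 : ℝ) * (ε / c2 k ^ k * x ^ (9 / 20 : ℝ)) :=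
            mul_le_mul_of_nonneg_left hpowx (by positivity)
        _ = ε * (x ^ (11 / 20 : ℝ) * x ^ (9 / 20 : ℝ)) := by field_simp
        _ = ε * x := by rw [hxsplit]
    calc c2 k ^ k * x ^ (11 / 20 : ℝ) ≤ ε * x / Real.log x ^ (k + 2) := by rw [le_div_iff₀ hlogpow]; exact h1
      _ ≤ ε * x / (polymathB x ^ k * polymathW x) := div_le_div_of_nonneg_left (by positivity) (by positivity) hden
      _ = ε * (x / (polymathB x ^ k * polymathW x)) := by ring

end StepD

/-! ### The theorem -/

section Final

/-- The constant of Proposition 4.2 (`a_j = 2`) for the family of cutoffs `E`. [folklore] -/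
def propConst (H : Finset ℤ) {E : ℤ → ℝ → ℝ} {sE : ℤ → ℝ} (hE : ∀ h ∈ H, IsSieveCutoff (E h) (sE h)) : ℝ :=
  (K₁ H.card + 1) * ∏ h ∈ H.attach, Mh (hE h h.2) (Nexp H.card)

/-- `0 ≤ C`. [folklore] -/
theorem propConst_nonneg (H : Finset ℤ) {E : ℤ → ℝ → ℝ} {sE : ℤ → ℝ} (hE : ∀ h ∈ H, IsSieveCutoff (E h) (sE h)) :
    0 ≤ propConst H hE := by
  unfold propConst K₁
  have : 0 ≤ countConst H.card := by linarith [two_le_countConst H.card]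
  have : 0 ≤ c2 H.card := by linarith [one_le_c2 H.card]
  have : 0 ≤ cF H.card := by linarith [one_le_cF H.card]
  refine mul_nonneg (by positivity) (Finset.prod_nonneg fun h _ => Mh_nonneg _ _)

/-- **Proposition 4.2, (lambdatau-fix2) with `a_j = 2`, `m_j = 0`.** For an admissible `H` (`k = #H ≥ 1`),
`b = b(x)` with `(b + h, W) = 1`, `h₀ ∈ H`, and any family of smooth compactly supported cutoffs
`E_h`, there is `C` such that for every `0 < ε < 1/(40k)`, for all large `x`,
`Σ_{x ≤ n ≤ 2x, n = b (W), p(n+h₀) ≤ x^ε} ∏_{h ∈ H} λ_{E_h}(n+h)² ≤ C ε x/(B^k W)`.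
[cite: Polymath8b2014, Proposition 4.2, (lambdatau-fix2)] -/
theorem sum_sq_divisorSumWeights_smallPrime_le (H : Finset ℤ) (hH : IsAdmissibleTuple H) (hk : 1 ≤ H.card)
    (b : ℝ → ℤ) (hb : ∀ x, ∀ h ∈ H, Int.gcd (b x + h) (polymathW x) = 1) {h₀ : ℤ} (hh₀ : h₀ ∈ H)
    (E : ℤ → ℝ → ℝ) (sE : ℤ → ℝ) (hE : ∀ h ∈ H, IsSieveCutoff (E h) (sE h))
    {ε : ℝ} (hε : 0 < ε) (hε1 : ε < 1 / (40 * (H.card : ℝ))) :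
    ∀ᶠ x : ℝ in atTop,
      ∑ n ∈ (polymathRange x (b x)).filter (badN (x ^ ε) h₀), ∏ h ∈ H, divisorSumWeight (E h) x (mOf n h) ^ 2 ≤
        propConst H hE * ε * (x / (polymathB x ^ H.card * polymathW x)) := by
  set k := H.card with hk'
  filter_upwards [eventually_hyps H hk hε hε1] with x hx
  obtain ⟨hx3, hxM, hWp, hB, hWc, hεy, hε2, hεlog, hrem⟩ := hx
  set X₀ := x / (polymathB x ^ k * polymathW x) with hX₀
  have hx1 : 1 < x := by linarith
  have hX₀nn : 0 ≤ X₀ := div_nonneg (by linarith) (mul_nonneg (pow_nonneg (polymathB_pos hx1).le _) (Nat.cast_nonneg _))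
  have hc2nn : 0 ≤ c2 k ^ k * x ^ (11 / 20 : ℝ) := by have := one_le_c2 k; positivity
  have hK₁nn : 0 ≤ K₁ k := by
    unfold K₁
    have : 0 ≤ countConst k := by linarith [two_le_countConst k]
    have : 0 ≤ c2 k := by linarith [one_le_c2 k]
    have : 0 ≤ cF k := by linarith [one_le_cF k]
    positivity
  -- Step B for every `σ ≥ 1`, then Step C with `T = H`
  have harith : ∀ σ : ℤ → ℝ, (∀ h ∈ H, 1 ≤ σ h) →
      arithQ H x (b x) (x ^ ε) h₀ σ ≤ (K₁ k * ε * X₀) * ∏ h ∈ H, σ h ^ Nexp k + c2 k ^ k * x ^ (11 / 20 : ℝ) :=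
    fun σ hσ => arith_bound hH hk hx3 hxM (hb x) hWp hB hWc hε hεy hε2 hεlog hh₀ σ hσ
  have hC := fourier_induction hx1 hxM (hb x) hc2nn harith E sE hE (subset_refl H) (fun _ => 1) fun h hh => by
    simp at hh
  rw [Finset.sdiff_self, Finset.prod_empty, mul_one] at hC
  have hmix : mixQ H H x (b x) (x ^ ε) h₀ E (fun _ => 1) =
      ∑ n ∈ (polymathRange x (b x)).filter (badN (x ^ ε) h₀), ∏ h ∈ H, divisorSumWeight (E h) x (mOf n h) ^ 2 := by
    rw [mixQ]; simp
  rw [← hmix]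
  refine hC.trans ?_
  have hMnn : 0 ≤ ∏ h ∈ H.attach, Mh (hE h h.2) (Nexp k) := Finset.prod_nonneg fun h _ => Mh_nonneg _ _
  calc (K₁ k * ε * X₀ + c2 k ^ k * x ^ (11 / 20 : ℝ)) * ∏ h ∈ H.attach, Mh (hE h h.2) (Nexp k)
      ≤ (K₁ k * ε * X₀ + ε * X₀) * ∏ h ∈ H.attach, Mh (hE h h.2) (Nexp k) :=
        mul_le_mul_of_nonneg_right (by linarith [hrem]) hMnn
    _ = propConst H hE * ε * X₀ := by rw [propConst]; ring

/-- `badN z h₀ n` says exactly that `n + h₀` is not `z`-rough. [folklore] -/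
theorem badN_iff_not_rough {z : ℝ} {h₀ : ℤ} {n : ℕ} (hn : mOf n h₀ ≠ 0) :
    badN z h₀ n ↔ ¬ (∀ p ∈ (mOf n h₀).primeFactorsList, z < (p : ℝ)) := by
  rw [badN]
  push Not
  constructor
  · rintro ⟨p, hp, hpd, hpz⟩
    exact ⟨p, (Nat.mem_primeFactorsList hn).2 ⟨hp, hpd⟩, hpz⟩
  · rintro ⟨p, hp, hpz⟩
    exact ⟨p, Nat.prime_of_mem_primeFactorsList hp, Nat.dvd_of_mem_primeFactorsList hp, hpz⟩

end Final

end SmallPrime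

end Literature.NumberTheory.Sieve
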